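import Summits.FinalStateConjecture.FinalStateConjecture.Theses.PhotonSphereChannels
import Summits.FinalStateConjecture.FinalStateConjecture.Theses.SwallowTheDatum
import Literature.Geometry.Lorentzian.KerrSchild
import Literature.Geometry.Lorentzian.KerrDataProofs
import Literature.Geometry.Lorentzian.KerrSchildCoord
import Literature.Geometry.Lorentzian.LorentzianDistance
import Literature.Geometry.Lorentzian.Hypersurface
import Literature.Geometry.Lorentzian.Einstein
import Literature.Geometry.Lorentzian.LeviCivitaProofs

/-!
# Line `crush-the-swallowed-interior` — LEAD'S WORKING SKELETON for the crux `PhotonSphereChannels.TameCensorship`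
(item stmt-FinalStateConjecture-10047; route route-FinalStateConjecture-PhotonSphereChannels, K3, rank 4)

Lead: prover-line-stmt-FinalStateConjecture-10047-0 (2026-08-16), building the planner's checked skeleton
`Cruxes/TameCensorship/Lines/crush-the-swallowed-interior.lean` (planner-cruxplan-…-crush-the-swallowed--0; idea card
`Cruxes/TameCensorship/Ideas/crush-the-swallowed-interior.md`, crux-ideate r1, ideator 3; triage r1-1/2/3: pass).

Lead reshapes (each re-registered with `ledger skeleton check`):
* wave 0 (2026-08-16): (a) `HawkingCrushBound` (Wald 1984 Thm 9.5.1) is the Literature named fact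
  `Literature.Geometry.Lorentzian.HawkingCrushBound`; it is a HYPOTHESIS of `stub_crush` (inlined verbatim) and of
  the composition through the REGISTERED stub `stub_hawkingCrushBound` (7th stub; = the known theorem, dischargeable only by
  the literature-prover debt `HawkingCrushBound_holds`; the skeleton audit admits no unregistered hypothesis); (b) every registered `stub_*` is restated DEF-FREE (Mathlib/Literature vocabulary only; the pushed
  Killing orbit passed as an honest curve, `orbit_mem_domain`; `IsCrushable` curried) so that stub-workers can land them as
  pure proofs in `Theorems/` without importing this workfile; the planner's folded statements are the `*_folded` bridges
  and the composition is unchanged over them; (c) REPAIR after the drefuter's `stub-misstated` notes on `stub_crush` /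
  `stub_nullTerminality` (`DrefuteStubCrush.md`, `DrefuteStubNullTerminality.md`, `CrushJunk.lean`, 2026-08-16): the vendored
  `futureCauchyDevelopment` (= `S` for closed `S`) is replaced everywhere (`IsCrushable`, `NullTerminality`, stubs C, N, R)
  by the FAITHFUL `futureDomainOfDependence` (past-ENDLESS curves), inlined in the registered statements.

## The line in one paragraph

`TameCensorship` says: for every `Σ`, the tame property `Q` (MGHD exists ∧ every MGHD has complete `𝓘⁺`,
(i) no late chart converging in `C²` to an EXTREMAL boosted Kerr near zone, (ii) uniformly bounded `C³` geometry
on `outer = J⁺(Σ) ∩ ⋃ I⁻(future-complete normalised null rays)`) is Christodoulou-generic (curve form).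
Curve-genericity carries no topology, so — exactly as on route SwallowTheDatum — it suffices to pass through
every admissible datum `d` the PARAMETRIC KERR BURIAL family `F` (`ParametricKerrBurial`, by name): every
`F c`, `c ≠ 0`, is an exact sub-extremal Kerr slice outside a compact set `K ⊂ Σ` sitting inside the black
hole. For such a member and any MGHD `𝒟`: `∃`-MGHD is `MGHDExists`, complete `𝓘⁺` is `KerrShieldedSettles`
(both by name). The two clauses of `Q` that READ THE INTERIOR are decided as follows. Split
`J⁺(ιΣ) = E ⊔ swallowed`, `swallowed := J⁺(ιK)` (future-closed), `E := J⁺(ιΣ) ∖ swallowed` (past-closed,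
EXACTLY Kerr `(M, a)` by domain of dependence — `stub_exactKerrBookkeeping`, which leans on
`SubdataDevelopmentsEmbed` by name). (i): a late chart from an extremal background pushes the stationary
Killing orbit of any point `x₀` with timelike Killing vector to a timelike curve of infinite length, which is
either future-going — then eventually in `J⁺(ιΣ)`, monotone, with unbounded Lorentzian distance along it — or
past-going (`stub_immortalObservers`). A future-going orbit never enters the swallowed region (crush, below),
so it lies in `E`; inside `E` the exact Kerr HOLE `{r < r₊}` has finite timelike diameter (Kerr region II), so
the orbit sits at `r ≥ r₊ > |a|`, where the phase of the Weyl scalar `Ψ₂ = −M/(r − i a cos θ)³` stays within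
`3·arctan(|a|/r₊) < 135°` of `π`, while on the extremal background at a polar near-horizon point it is within
`o(1)` of `−45°`: no `C²`-converging chart can put that point's late orbit there (`stub_phaseRigidity`).
(ii): a future-complete ray either meets the swallowed region or stays in `E` at `r ≥ r₊`, where uniform Kerr
ball charts exist (bookkeeping). THE CRUSH (`stub_crush`, the card's lever): if the swallowed region is
CRUSHABLE — covered, up to a compact set, by the chronological future of a closed achronal uniformly
contracting spacelike hypersurface `S″` that is future-Cauchy for its own future (membrane `{r = r₀ < 3M/2}`
in the exact layer + a prescribed-mean-curvature cap over the core) — then by Hawking 1967 / Wald 1984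
Thm 9.5.1 (time-reversed: `H ≤ −ε` ⇒ every future timelike curve from `S″` is shorter than `3/ε`) it contains
NO immortal point, and by NULL TERMINALITY (`stub_nullTerminality`, the card's riskiest soft lemma,
hypersurface form) plus non-imprisonment it meets NO future-complete null ray. What burial + crush cannot
reach is isolated in ONE residue stub (`stub_residue`, named by all three triagers): (R2) no PAST-going
extremal orbit (clause (i) is two-sided in time, Disproof.lean §6 `timeReversal_mem_lorentzGroup`; = the
dynamical third law for the time-reversed cored datum) and (R1) UNCRUSHABLE swallowed sectors (eternal hidden
futures: vacuum bags, expanding fillings of `Y # ℝ³`) are nevertheless tame in the sense of (i),(ii). Both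
residues are VACUOUS under the lockstep repair of K3/K2 recommended by the triage (restrict (i) to charts into
`J⁺(ιΣ)` and (i),(ii) to the visible sector); this skeleton targets the LITERAL decl.

## Shape

`theorem TameCensorship_of (hB : ParametricKerrBurial) (hS : KerrShieldedSettles) (hE : SubdataDevelopmentsEmbed)
(hM : MGHDExists) : TameCensorship` — hypotheses = the four route items of SwallowTheDatum BY NAME (inherited
debts, no restatement); the proof is pure logic over the six `stub_*` theorems of this file (each `sorry`):
`stub_exactKerrBookkeeping`, `stub_immortalObservers`, `stub_phaseRigidity`, `stub_crush`,
`stub_nullTerminality`, `stub_residue`. Stubs share only CANONICAL objects defined here (`swallowed`,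
`orbitPt`, `IsPastGoingOrbit`, `IsImmortal`, `BallChart`, `IsExactKerrOn`, `IsCrushable`, `NullTerminality`).
`HawkingCrushBound` (Wald 9.5.1, typed by the ideator, rc 0) is kept as the cited tool of `stub_crush`
(Literature fact request), not as a stub.

Disproof.lean used: §6 (two-sidedness of (i)) is honoured by the explicit past disjunct of
`stub_immortalObservers` and residue (R2); §4 (`isChristodoulouGeneric_and_fails`: ∧ is not free) is
honoured because ONE family (the burial) carries all clauses at once; §2/§3/§5/§7: no instance of `Q` is
decidable in the tree either way, and no stub is an instance of a landed Negative lemma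
(`Theorems/TameCensorship/Negative/{ExistentialContent,GenericityModel,GenericityAndFails}` concern the
genericity bookkeeping, not these objects).
-/

open scoped Manifold ContDiff Topology ENNReal NNReal
open Set Filter Bundle
open Literature.Geometry.Lorentzian
open Summit.FinalStateConjecture.FinalStateConjecture.Theses.PhotonSphereChannels (TameCensorship)
open Summit.FinalStateConjecture.FinalStateConjecture.Theses.SwallowTheDatum
  (ParametricKerrBurial KerrShieldedSettles SubdataDevelopmentsEmbed MGHDExists)

set_option linter.dupNamespace false
set_option linter.unusedVariables false

noncomputable section

namespace Summit.FinalStateConjecture.FinalStateConjecture.Cruxes.TameCensorship.CrushTheSwallowedInterior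

/-- The instance hypothesis `[Kerr.Facts]` of the Kerr–Schild prelude, discharged by the tree's theorems
(as in `Theorems/SwallowTheDatumTargetGlue.lean`). -/
instance instKerrFacts : Kerr.Facts :=
  ⟨Kerr.isConnected_region_holds, Kerr.contMDiff_bilin_holds, Kerr.contMDiff_timeVector_holds⟩

/-! ## Canonical objects -/

/-- **Hawking's crush bound** (Wald 1984, Thm. 9.5.1, future form) — VERBATIM the Literature named fact
`Literature.Geometry.Lorentzian.HawkingCrushBound` at universe `0` (module `Literature/Geometry/Lorentzian/HawkingCrushBound.lean`,
landed 2026-08-16T01:11Z). Local verbatim copy (the Lean farm had not built that module when this skeleton was registered: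
`lean check` rc 75 `remote:stale:unbuilt`); it is the statement of the registered stub `stub_hawkingCrushBound` and the first
hypothesis of `stub_crush` (inlined there). -/
abbrev HawkingCrushBound₀ : Prop :=
  ∀ (𝓢 : Spacetime.{0} 4) [𝓢.metric.HasLeviCivita],
    𝓢.metric.IsGloballyHyperbolic 𝓢.timeOrientation →
    𝓢.metric.SatisfiesTimelikeConvergence →
    ∀ (N : Type) [TopologicalSpace N] [ChartedSpace E3 N] [IsManifold (𝓡 3) ∞ N]
      (f : N → 𝓢.carrier)
      (hpb : PseudoRiemannianMetric.contMDiff_pullbackBilin (𝓡 4) 𝓢.carrier (𝓡 3) N ∞)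
      (hf : 𝓢.metric.IsSpacelikeImmersion (𝓡 3) f) (ν : NormalField (𝓡 4) f),
      ContMDiff (𝓡 3) (𝓡 4).tangent ∞
        (fun y ↦ (TotalSpace.mk' E4 (f y) (ν y) : TangentBundle (𝓡 4) 𝓢.carrier)) →
      𝓢.metric.IsFutureUnitNormal (𝓡 3) 𝓢.timeOrientation f ν →
      𝓢.metric.IsCauchyHypersurface 𝓢.timeOrientation (Set.range f) →
      ∀ C : ℝ, 0 < C → (∀ y, 𝓢.metric.meanCurvature f hpb hf ν y ≤ -C) →
      ∀ (y : N) (q : 𝓢.carrier), 𝓢.lorentzDist (f y) q ≤ ENNReal.ofReal (3 / C)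


section Objects

variable {X : Type} [TopologicalSpace X] [ChartedSpace E3 X] [IsManifold (𝓡 3) ∞ X] [T2Space X]
  [SecondCountableTopology X] [ConnectedSpace X]

/-- **Kerr-shielded with explicit parameters**: VERBATIM the member clause of
`SwallowTheDatum.ParametricKerrBurial` (stmt-10052) = the hypothesis of `KerrShieldedSettles` (stmt-10054)
for the datum `D` — sub-extremal `(M, a)`, junction radius `r₋ < r₁ < r₊`, the bent height `T`, a smooth open
embedding `φ : Kerr.slice a r₁ → X` with COMPACT complement of its range, the graph `ψ` of `T` into the
ingoing Kerr–Schild chart, spacelike with future unit normal `ν`, and `φ^* h = ψ^* g_{M,a}`, `φ^* k = K_ν(ψ)`: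
outside the compact set `(range φ)ᶜ` the datum IS an exact Kerr slice entering the black hole. -/
def IsKerrShieldedWith (D : InitialDataSet (𝓡 3) X) (M a r₁ : ℝ) (hM : 0 ≤ M) (T : ℝ → ℝ)
    (φ : Kerr.slice a r₁ → X) (ψ : Kerr.slice a r₁ → Kerr.region a r₁)
    (ν : NormalField 𝓘(ℝ, E4) ψ) : Prop :=
  |a| < M ∧ Kerr.rMinus M a < r₁ ∧ r₁ < Kerr.rPlus M a ∧
    T = (fun r : ℝ => Real.smoothTransition (r / (4 * M) - 1) * (((M) / Real.sqrt ((M) ^ 2 - (a) ^ 2)) * (Kerr.rPlus M a * Real.log (r - Kerr.rPlus M a) - Kerr.rMinus M a * Real.log (r - Kerr.rMinus M a)) - ((M) / Real.sqrt ((M) ^ 2 - (a) ^ 2)) * (Kerr.rPlus M a * Real.log ((4 * M) - Kerr.rPlus M a) - Kerr.rMinus M a * Real.log ((4 * M) - Kerr.rMinus M a)))) ∧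
    IsCompact (Set.range φ)ᶜ ∧ Topology.IsOpenEmbedding φ ∧ ContMDiff 𝓘(ℝ, E3) (𝓡 3) ((⊤ : ℕ∞) : WithTop ℕ∞) φ ∧
    (∀ y : Kerr.slice a r₁, (ψ y : E4) = E4.ofTimeSpace (T (Kerr.radius a (E4.ofTimeSpace 0 (y : E3)))) (y : E3)) ∧
    (Kerr.smoothMetric M a r₁).IsSpacelikeImmersion 𝓘(ℝ, E3) ψ ∧
    (Kerr.smoothMetric M a r₁).IsFutureUnitNormal 𝓘(ℝ, E3) ((Kerr.timeOrientation M a r₁ hM).ofLE le_top) ψ ν ∧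
    (∀ y : Kerr.slice a r₁, pullbackBilin (I := 𝓡 3) (I' := 𝓘(ℝ, E3)) φ D.h.inner y = pullbackBilin (I := 𝓘(ℝ, E4)) (I' := 𝓘(ℝ, E3)) ψ (Kerr.smoothMetric M a r₁).val y) ∧
    (∀ [(Kerr.smoothMetric M a r₁).HasLeviCivita] (y : Kerr.slice a r₁), (pullbackBilin (I := 𝓡 3) (I' := 𝓘(ℝ, E3)) φ D.k y).toLinearMap₁₂ = (Kerr.smoothMetric M a r₁).secondFundamentalForm 𝓘(ℝ, E3) ψ ν y)

/-- The **swallowed region** of a development `𝒟` relative to a subset `K ⊆ X` of the data manifold (for a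
shielded member: `K = (range φ)ᶜ`, the compact non-exact core + gluing annulus): the causal future
`J⁺(ι K)` of its image. Its complement in `J⁺(ιX)` is the region decided by the exact Kerr data alone. -/
def swallowed {D : InitialDataSet (𝓡 3) X} (𝒟 : VacuumCauchyDevelopment D) (K : Set X) :
    Set 𝒟.carrier :=
  𝒟.metric.causalFuture 𝒟.timeOrientation (𝒟.embed '' K)

end Objects

/-- A point `m` of a spacetime is **immortal**: future causal curves from `m` have unbounded length
(`sup_q d(m, q) = ∞`). -/
def IsImmortal (𝓢 : Spacetime.{0} 4) (m : 𝓢.carrier) : Prop :=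
  ∀ τ : ℝ≥0, ∃ q : 𝓢.carrier, (τ : ℝ≥0∞) < 𝓢.lorentzDist m q

/-- **Tameness chart at `q`, scale `r`, bound `Λ`** — VERBATIM the inner block of clause (ii) of the crux: a
late chart `Ψ` of the Minkowski background on the coordinate ball of radius `r`, centred at `q`
(`Ψ 0 = q`), with `sup_{C³} |Ψ^* g − η| ≤ Λ` and `sup_{C⁰} |Ψ^* g − η| ≤ 1/2` on the ball. -/
def BallChart (𝓢 : Spacetime.{0} 4) (q : 𝓢.carrier) (r : ℝ) (Λ : ℝ≥0) : Prop :=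
  let U : TopologicalSpace.Opens E4 := ⟨Metric.ball (0 : E4) r, Metric.isOpen_ball⟩
  ∃ Ψ : U → 𝓢.carrier, 𝓢.IsLateChart (Minkowski.backgroundOn U) Set.univ (-r) Ψ ∧
    (∃ x : U, (x : E4) = 0 ∧ Ψ x = q) ∧
    supCkENorm (U : Set E4) 3 (𝓢.deviationExtend (Minkowski.backgroundOn U) Ψ) ≤ (Λ : ℝ≥0∞) ∧
    supCkENorm (U : Set E4) 0 (𝓢.deviationExtend (Minkowski.backgroundOn U) Ψ) ≤ 1 / 2

/-- Monotonicity of `BallChart` in the `C³` bound. -/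
theorem BallChart.mono {𝓢 : Spacetime.{0} 4} {q : 𝓢.carrier} {r : ℝ} {Λ Λ' : ℝ≥0} (h : Λ ≤ Λ')
    (hq : BallChart 𝓢 q r Λ) : BallChart 𝓢 q r Λ' := by
  obtain ⟨Ψ, h₁, h₂, h₃, h₄⟩ := hq
  exact ⟨Ψ, h₁, h₂, h₃.trans (ENNReal.coe_le_coe.2 h), h₄⟩

/-- The **stationary Killing direction** `Λ e₀` of the boosted Kerr–Schild background `(Λ, c, M, a)`: the
constant vector whose flow `x ↦ x + s Λ e₀` advances the rest-frame time `t* = (Λ⁻¹(x − c))⁰` by `s` and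
fixes the rest-frame Kerr–Schild radius (O'Neill 1995, Ch. 2, §2.2; Kerr–Schild 1965). -/
def killingDir (Λ : lorentzGroup) : E4 :=
  (Λ : E4 ≃L[ℝ] E4) (EuclideanSpace.single (0 : Fin 4) (1 : ℝ))

/-- Rest-frame coordinates of the translate `x + s Λe₀`: `Λ⁻¹(x + sΛe₀ − c) = Λ⁻¹(x − c) + s e₀`. -/
theorem poincareInv_add_smul_killingDir (Λ : lorentzGroup) (c : E4) (x : E4) (s : ℝ) :
    poincareInv Λ c (x + s • killingDir Λ) = poincareInv Λ c x + s • E4.basisVector 0 := by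
  simp only [poincareInv, E4.basisVector, killingDir]
  rw [show x + s • (Λ : E4 ≃L[ℝ] E4) (EuclideanSpace.single (0 : Fin 4) (1 : ℝ)) - c
      = (x - c) + s • (Λ : E4 ≃L[ℝ] E4) (EuclideanSpace.single (0 : Fin 4) (1 : ℝ)) by abel,
    map_add, map_smul, ContinuousLinearEquiv.symm_apply_apply]

/-- **The Killing orbit stays in the boosted exterior**: `x₀ + s Λe₀ ∈ (boostedKerrBackground Λ c M a).domain`
for every `s` (the rest-frame Kerr–Schild radius is `t*`-independent, `Kerr.radius_add_time_smul_basisVector`).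
This is why the stubs may quantify the pushed orbit as an honest curve `γ s = Ψ ⟨x₀ + sΛe₀, _⟩` (no junk branch). -/
theorem orbit_mem_domain (Λ : lorentzGroup) (c : E4) (M a : ℝ)
    (x₀ : (boostedKerrBackground Λ c M a).domain) (s : ℝ) :
    (x₀ : E4) + s • killingDir Λ ∈ (boostedKerrBackground Λ c M a).domain := by
  have hx : poincareInv Λ c (x₀ : E4) ∈ Kerr.exterior M a := mem_boostedKerrExterior.1 x₀.2
  show _ ∈ boostedKerrExterior Λ c M a
  rw [mem_boostedKerrExterior, poincareInv_add_smul_killingDir, Kerr.mem_exterior,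
    Kerr.radius_add_time_smul_basisVector]
  exact Kerr.mem_exterior.1 hx

/-- The **pushed Killing orbit** of the background point `x₀` under the chart `Ψ`: `s ↦ Ψ(x₀ + s Λe₀)` (total and
honest: the orbit stays in the boosted exterior, `orbit_mem_domain`). -/
def orbitPt (Λ : lorentzGroup) (c : E4) (M a : ℝ) (𝓢 : Spacetime.{0} 4)
    (Ψ : (boostedKerrBackground Λ c M a).domain → 𝓢.carrier)
    (x₀ : (boostedKerrBackground Λ c M a).domain) (s : ℝ) : 𝓢.carrier :=
  Ψ ⟨(x₀ : E4) + s • killingDir Λ, orbit_mem_domain Λ c M a x₀ s⟩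

/-- The chart `Ψ` is **past-going along the orbit of `x₀`**: the pushed Killing orbit is eventually a
PAST-directed timelike curve of `𝓢` (orientation-reversing charts are admitted by `IsLateChart … Set.univ`,
which has no time-orientation field — Disproof.lean §6). -/
def IsPastGoingOrbit (Λ : lorentzGroup) (c : E4) (M a : ℝ) (𝓢 : Spacetime.{0} 4)
    (Ψ : (boostedKerrBackground Λ c M a).domain → 𝓢.carrier)
    (x₀ : (boostedKerrBackground Λ c M a).domain) : Prop :=
  ∃ s₀ : ℝ, 𝓢.metric.IsFutureTimelikeCurveOn 𝓢.timeOrientation.reverse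
    (orbitPt Λ c M a 𝓢 Ψ x₀) (Set.Ici s₀)

/-- The metric of `𝓢` is **exactly Kerr `(M, a)` on the open set `E`** via `χ`: `χ` is smooth on `E` and
pulls the Kerr–Schild metric of `Kerr.spacetime M a r₀` back to `g` at every point of `E` (a local isometry
INTO the ingoing chart region `{r > max r₀ 0}`; in particular `r ∘ χ > r₀` on `E` by typing). -/
def IsExactKerrOn (𝓢 : Spacetime.{0} 4) (E : Set 𝓢.carrier) (M a r₀ : ℝ) (hM : 0 ≤ M)
    (χ : 𝓢.carrier → (Kerr.spacetime M a r₀ hM).carrier) : Prop :=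
  IsOpen E ∧ ContMDiffOn (𝓡 4) (𝓡 4) ∞ χ E ∧
    ∀ p ∈ E, pullbackBilin (I := 𝓡 4) (I' := 𝓡 4) χ (Kerr.spacetime M a r₀ hM).metric.val p =
      𝓢.metric.val p

/-- The **faithful future domain of dependence** `D⁺(S)` of `S ⊆ 𝓢`: the points `p` such that every
past-ENDLESS (`IsPastEndless`, the tree's faithful inextendibility, `Causality.lean` §"faithful notions")
future-directed causal curve through `p` meets `S` at or before `p`. REPAIR (drefuter note `DrefuteStubCrush.md`,
2026-08-16, kernel-checked in its `CrushJunk.lean`): the vendored `LorentzianMetric.futureCauchyDevelopment` is built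
on the mis-formalised `IsPastInextendible` and equals `S` for every CLOSED `S`, which made `IsCrushable` collapse to
"`J⁺(ιK)` relatively compact" (every crush hypersurface empty) and `NullTerminality` vacuous. With this set in their
place both regain their intended content. Hawking–Ellis 1973, §6.5; O'Neill 1983, Ch. 14, Def. 14.35. -/
def futureDomainOfDependence (𝓢 : Spacetime.{0} 4) (S : Set 𝓢.carrier) : Set 𝓢.carrier :=
  {p | ∀ (β : ℝ → 𝓢.carrier) (s : Set ℝ), s.OrdConnected →
    𝓢.metric.IsFutureCausalCurveOn 𝓢.timeOrientation β s → IsPastEndless β s →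
    ∀ t₀ ∈ s, β t₀ = p → ∃ t ∈ s, t ≤ t₀ ∧ β t ∈ S}

section Crush

variable {X : Type} [TopologicalSpace X] [ChartedSpace E3 X] [IsManifold (𝓡 3) ∞ X] [T2Space X]
  [SecondCountableTopology X] [ConnectedSpace X]

/-- The swallowed region of `𝒟` relative to `K ⊆ X` is **crushable**: there is a smooth spacelike
hypersurface `f : N → 𝒟` with smooth future unit normal `ν`, UNIFORMLY CONTRACTING (`H = div ν ≤ −ε < 0`,
tree sign convention of `meanCurvature`), with closed ACHRONAL image `S″ = range f` that is future-Cauchy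
for its own future (`J⁺(S″) ⊆ D⁺(S″)`: every past-inextendible causal curve from a point of `J⁺(S″)` meets
`S″`), and whose chronological future covers the swallowed region up to a compact set
(`J⁺(ιK) ⊆ C ∪ I⁺(S″)`, `C` compact). Intended witness for a buried member (idea card S2): the one-way
membrane `{r = r₀}`, `r₀ < 3M/2`, of the exact Schwarzschild/Kerr layer, capped over the core by a
prescribed-mean-curvature hypersurface in the core's own domain of dependence (Bartnik 1984/1988; the convex
corner between membrane and cap smoothed inside the exact layer, where both pieces contract) — this is where
ROOM-CRUSH lives; a core carrying an eternal hidden future (vacuum bag, expanding filling of `Y # ℝ³`) is NOT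
crushable, by Hawking's bound itself (triage r1-1/2/3). -/
def IsCrushable {D : InitialDataSet (𝓡 3) X} (𝒟 : VacuumCauchyDevelopment D) [𝒟.metric.HasLeviCivita]
    (K : Set X) : Prop :=
  ∃ (N : Type) (_ : TopologicalSpace N) (_ : ChartedSpace E3 N) (_ : IsManifold (𝓡 3) ∞ N)
    (f : N → 𝒟.carrier)
    (hpb : PseudoRiemannianMetric.contMDiff_pullbackBilin (𝓡 4) 𝒟.carrier (𝓡 3) N ∞)
    (hf : 𝒟.metric.IsSpacelikeImmersion (𝓡 3) f) (ν : NormalField (𝓡 4) f) (ε : ℝ),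
    0 < ε ∧
    ContMDiff (𝓡 3) (𝓡 4).tangent ∞
      (fun y ↦ (TotalSpace.mk' E4 (f y) (ν y) : TangentBundle (𝓡 4) 𝒟.carrier)) ∧
    𝒟.metric.IsFutureUnitNormal (𝓡 3) 𝒟.timeOrientation f ν ∧
    (∀ y, 𝒟.metric.meanCurvature f hpb hf ν y ≤ -ε) ∧
    IsClosed (Set.range f) ∧ 𝒟.metric.IsAchronal 𝒟.timeOrientation (Set.range f) ∧
    𝒟.metric.causalFuture 𝒟.timeOrientation (Set.range f) ⊆
      futureDomainOfDependence 𝒟.toSpacetime (Set.range f) ∧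
    ∃ C : Set 𝒟.carrier, IsCompact C ∧
      swallowed 𝒟 K ⊆ C ∪ 𝒟.metric.chronologicalFuture 𝒟.timeOrientation (Set.range f)

/-- **NULL TERMINALITY** (hypersurface form; the card's proposed soft lemma S6, conjectural): in a MAXIMAL
vacuum Cauchy development, a maximal (inextendible) geodesic which is null and future-directed somewhere and
which eventually stays inside the future Cauchy development `D⁺(S″)` of a closed achronal UNIFORMLY
CONTRACTING smooth spacelike hypersurface `S″` has affine domain bounded above — the null companion of
Hawking's timelike bound. Evidence (idea card): Minkowski past hyperboloids, Kasner (`p ≥ −1/3`),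
Taub/Misner (HE §5.8), every contracting vacuum Bianchi class-A model via the monotone quantity `|θ|·E`
(`d ln(HE)/dT ≥ 3/2`; kit j006481 for Mixmaster); what would kill it: an inhomogeneous vacuum crush with a
complete null geodesic threading the cut locus of `S″` (e.g. a compactly generated Cauchy horizon approached
from the crushed side). -/
def NullTerminality : Prop :=
  ∀ (Y : Type) [TopologicalSpace Y] [ChartedSpace E3 Y] [IsManifold (𝓡 3) ∞ Y] [T2Space Y]
    [SecondCountableTopology Y] [ConnectedSpace Y] (DY : InitialDataSet (𝓡 3) Y)
    (𝒟 : VacuumCauchyDevelopment DY), 𝒟.IsMaximal → ∀ [𝒟.metric.HasLeviCivita]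
    (N : Type) [TopologicalSpace N] [ChartedSpace E3 N] [IsManifold (𝓡 3) ∞ N] (f : N → 𝒟.carrier)
    (hpb : PseudoRiemannianMetric.contMDiff_pullbackBilin (𝓡 4) 𝒟.carrier (𝓡 3) N ∞)
    (hf : 𝒟.metric.IsSpacelikeImmersion (𝓡 3) f) (ν : NormalField (𝓡 4) f),
    ContMDiff (𝓡 3) (𝓡 4).tangent ∞
      (fun y ↦ (TotalSpace.mk' E4 (f y) (ν y) : TangentBundle (𝓡 4) 𝒟.carrier)) →
    𝒟.metric.IsFutureUnitNormal (𝓡 3) 𝒟.timeOrientation f ν →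
    IsClosed (Set.range f) → 𝒟.metric.IsAchronal 𝒟.timeOrientation (Set.range f) →
    ∀ ε : ℝ, 0 < ε → (∀ y, 𝒟.metric.meanCurvature f hpb hf ν y ≤ -ε) →
    ∀ (γ : ℝ → 𝒟.carrier) (dom : Set ℝ), IsMaximalGeodesicOn 𝒟.metric.leviCivita γ dom →
      (∃ t ∈ dom, 𝒟.metric.IsNull (velocity (𝓡 4) γ t) ∧
        𝒟.timeOrientation.IsFutureDirected (velocity (𝓡 4) γ t)) →
      (∃ t₀ ∈ dom, ∀ t ∈ dom, t₀ ≤ t →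
        γ t ∈ futureDomainOfDependence 𝒟.toSpacetime (Set.range f)) →
      BddAbove dom

-- `HawkingCrushBound` (Wald 1984 Thm 9.5.1, future form) is the Literature named fact
-- `Literature.Geometry.Lorentzian.HawkingCrushBound` (Literature/Geometry/Lorentzian/HawkingCrushBound.lean),
-- imported above and taken BY NAME as a hypothesis of `stub_crush` / `TameCensorship_of` (lead reshape, wave 0).

end Crush


section Sectors

variable {X : Type} [TopologicalSpace X] [ChartedSpace E3 X] [IsManifold (𝓡 3) ∞ X] [T2Space X]
  [SecondCountableTopology X] [ConnectedSpace X]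

/-- The **exact part** `E = J⁺(ιX) ∖ swallowed`: the points to the future of the data hypersurface that
are NOT causally influenced by `ι K` (for a shielded member: decided by the exact Kerr slice alone). -/
def exactPart {D : InitialDataSet (𝓡 3) X} (𝒟 : VacuumCauchyDevelopment D) (K : Set X) :
    Set 𝒟.carrier :=
  𝒟.metric.causalFuture 𝒟.timeOrientation (Set.range 𝒟.embed) \ swallowed 𝒟 K

/-- **(R1a-shape) No extremal orbit is swallowed**: for every late chart `Ψ` from a boosted EXTREMAL Kerr
background with near-zone `C²` deviation `→ 0`, and every background point `x₀` with timelike Killing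
vector, the pushed Killing orbit of `x₀` is NOT eventually inside the swallowed region `J⁺(ι K)`. -/
def NoOrbitSwallowed {D : InitialDataSet (𝓡 3) X} (𝒟 : VacuumCauchyDevelopment D) (K : Set X) : Prop :=
  ∀ (Λ : lorentzGroup) (c : E4) (M' a' : ℝ), Kerr.IsExtremal M' a' →
    ∀ (τ₀ : ℝ) (Ψ : (boostedKerrBackground Λ c M' a').domain → 𝒟.carrier),
      𝒟.toSpacetime.IsLateChart (boostedKerrBackground Λ c M' a') Set.univ τ₀ Ψ →
      (∀ R : ℝ, Tendsto (fun τ => 𝒟.toSpacetime.truncDeviationCk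
        (boostedKerrBackground Λ c M' a') Ψ 2 R τ) atTop (𝓝 0)) →
      ∀ x₀ : (boostedKerrBackground Λ c M' a').domain,
        (boostedKerrBackground Λ c M' a').bilin x₀.1 (killingDir Λ) (killingDir Λ) < 0 →
        ¬ ∃ s₀ : ℝ, ∀ s : ℝ, s₀ ≤ s → orbitPt Λ c M' a' 𝒟.toSpacetime Ψ x₀ s ∈ swallowed 𝒟 K

/-- **(R1b-shape) Swallowed rays see only tame geometry**: there is a scale `r_b > 0` such that for every
smaller scale `r'` some bound `Λ'` works: every point of `J⁺(ιX)` in the chronological past of the future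
half of a future-COMPLETE normalised null ray from the data hypersurface WHICH MEETS the swallowed region
carries a tameness ball chart of scale `r'` and `C³` bound `Λ'` (`BallChart`). -/
def SwallowedRaysTame {D : InitialDataSet (𝓡 3) X} (𝒟 : VacuumCauchyDevelopment D)
    [𝒟.metric.HasLeviCivita] (K : Set X) : Prop :=
  ∃ rb : ℝ, 0 < rb ∧ ∀ r' : ℝ, 0 < r' → r' ≤ rb → ∃ Λ' : ℝ≥0,
    ∀ q ∈ 𝒟.metric.causalFuture 𝒟.timeOrientation (Set.range 𝒟.embed),
    ∀ (p : X) (γ : ℝ → 𝒟.carrier) (dom : Set ℝ),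
      𝒟.metric.IsNormalisedNullRayFrom 𝒟.timeOrientation 𝒟.embed 𝒟.normal p γ dom → ¬ BddAbove dom →
      q ∈ 𝒟.metric.chronologicalPast 𝒟.timeOrientation (γ '' (dom ∩ Set.Ici 0)) →
      (γ '' (dom ∩ Set.Ici 0) ∩ swallowed 𝒟 K).Nonempty → BallChart 𝒟.toSpacetime q r' Λ'

end Sectors

/-! ## The stubs (REGISTERED statements, in DEF-FREE form)

Lead reshape (wave 0, 2026-08-16): every registered `stub_*` is stated over Mathlib/Literature vocabulary ONLY
(no canonical object of this file appears in a registered signature), so that a stub-worker's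
`Theorems/PhotonSphereChannelsTameCensorship<Stub>.lean` — which cannot import `Cruxes/` — can state it verbatim and
land it kernel-reviewed (pure proof, no new def). The canonical objects above are definitionally the inlined
texts; the `*_folded` lemmas below recover the planner's folded statements from the stubs by `rfl`-level
bridging (the pushed Killing orbit is passed as an honest curve `γ s = Ψ ⟨x₀ + sΛe₀, _⟩`, `orbit_mem_domain`),
and the composition `TameCensorship_of` is the planner's, verbatim, over the folded lemmas. Statement CONTENT is
unchanged except: `stub_crush` takes Hawking's bound (Wald 1984 Thm 9.5.1 = Literature named fact
`Literature.Geometry.Lorentzian.HawkingCrushBound`, inlined verbatim at universe 0) as an explicit hypothesis, and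
`IsCrushable` is curried. -/

/-- **STUB B — exact-Kerr bookkeeping** (def-free form of the planner's statement; `[Kerr.Facts]` bound inside).
`SubdataDevelopmentsEmbed →` for a Kerr-shielded admissible datum (the shielding block = VERBATIM the member clause of
`SwallowTheDatum.ParametricKerrBurial`, stmt-10052) and any MGHD `𝒟`, with `K = (range φ)ᶜ`, `swallowed = J⁺(ιK)`,
`E = J⁺(ιX) ∖ swallowed`: (B1) `E ⊆ E'` for an OPEN `E'` on which `g` is EXACTLY Kerr `(M, a)` via a smooth
`χ : 𝒟 → Kerr.spacetime M a r₋`; (B2) `swallowed` is future-closed; (B3) the hole is mortal within `E` (one `C` bounds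
`d(p, q)`, `p, q ∈ E`, `r(χ p) < r₊`); (B4) every point of `J⁺(ιX)` in the chronological past of the future half of a
future-complete normalised null ray is seen through a ray meeting `swallowed` or carries a Minkowski-ball chart of every
scale `r' ≤ r_b` with `C³` bound `Λ_b(r')`. Size L (XL in today's tree). Leans on `SubdataDevelopmentsEmbed` (by name),
`Kerr.spacetime`, `KerrHorizonCausality`, `KerrDomainOfDependence`, `causalFuture_causalFuture_eq`. -/
theorem stub_exactKerrBookkeeping : ∀ [Kerr.Facts], SubdataDevelopmentsEmbed →
    ∀ (X : Type) [TopologicalSpace X] [ChartedSpace E3 X] [IsManifold (𝓡 3) ∞ X] [T2Space X]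
      [SecondCountableTopology X] [ConnectedSpace X],
    ∀ D ∈ admissibleVacuumData X,
    ∀ (M a r₁ : ℝ) (hM : 0 ≤ M) (T : ℝ → ℝ) (φ : Kerr.slice a r₁ → X)
      (ψ : Kerr.slice a r₁ → Kerr.region a r₁) (ν : NormalField 𝓘(ℝ, E4) ψ),
      (|a| < M ∧ Kerr.rMinus M a < r₁ ∧ r₁ < Kerr.rPlus M a ∧
        T = (fun r : ℝ => Real.smoothTransition (r / (4 * M) - 1) * (((M) / Real.sqrt ((M) ^ 2 - (a) ^ 2)) * (Kerr.rPlus M a * Real.log (r - Kerr.rPlus M a) - Kerr.rMinus M a * Real.log (r - Kerr.rMinus M a)) - ((M) / Real.sqrt ((M) ^ 2 - (a) ^ 2)) * (Kerr.rPlus M a * Real.log ((4 * M) - Kerr.rPlus M a) - Kerr.rMinus M a * Real.log ((4 * M) - Kerr.rMinus M a)))) ∧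
        IsCompact (Set.range φ)ᶜ ∧ Topology.IsOpenEmbedding φ ∧ ContMDiff 𝓘(ℝ, E3) (𝓡 3) ((⊤ : ℕ∞) : WithTop ℕ∞) φ ∧
        (∀ y : Kerr.slice a r₁, (ψ y : E4) = E4.ofTimeSpace (T (Kerr.radius a (E4.ofTimeSpace 0 (y : E3)))) (y : E3)) ∧
        (Kerr.smoothMetric M a r₁).IsSpacelikeImmersion 𝓘(ℝ, E3) ψ ∧
        (Kerr.smoothMetric M a r₁).IsFutureUnitNormal 𝓘(ℝ, E3) ((Kerr.timeOrientation M a r₁ hM).ofLE le_top) ψ ν ∧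
        (∀ y : Kerr.slice a r₁, pullbackBilin (I := 𝓡 3) (I' := 𝓘(ℝ, E3)) φ D.h.inner y = pullbackBilin (I := 𝓘(ℝ, E4)) (I' := 𝓘(ℝ, E3)) ψ (Kerr.smoothMetric M a r₁).val y) ∧
        (∀ [(Kerr.smoothMetric M a r₁).HasLeviCivita] (y : Kerr.slice a r₁), (pullbackBilin (I := 𝓡 3) (I' := 𝓘(ℝ, E3)) φ D.k y).toLinearMap₁₂ = (Kerr.smoothMetric M a r₁).secondFundamentalForm 𝓘(ℝ, E3) ψ ν y)) →
    ∀ 𝒟 : VacuumCauchyDevelopment D, 𝒟.IsMaximal → ∀ [𝒟.metric.HasLeviCivita],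
      ∃ (E' : Set 𝒟.carrier) (χ : 𝒟.carrier → (Kerr.spacetime M a (Kerr.rMinus M a) hM).carrier),
        (𝒟.metric.causalFuture 𝒟.timeOrientation (Set.range 𝒟.embed) \
            𝒟.metric.causalFuture 𝒟.timeOrientation (𝒟.embed '' (Set.range φ)ᶜ)) ⊆ E' ∧
        (IsOpen E' ∧ ContMDiffOn (𝓡 4) (𝓡 4) ∞ χ E' ∧
          ∀ p ∈ E', pullbackBilin (I := 𝓡 4) (I' := 𝓡 4) χ
            (Kerr.spacetime M a (Kerr.rMinus M a) hM).metric.val p = 𝒟.metric.val p) ∧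
        (∀ m ∈ 𝒟.metric.causalFuture 𝒟.timeOrientation (𝒟.embed '' (Set.range φ)ᶜ),
          𝒟.metric.causalFuture 𝒟.timeOrientation {m} ⊆
            𝒟.metric.causalFuture 𝒟.timeOrientation (𝒟.embed '' (Set.range φ)ᶜ)) ∧
        (∃ C : ℝ≥0, ∀ p ∈ (𝒟.metric.causalFuture 𝒟.timeOrientation (Set.range 𝒟.embed) \
            𝒟.metric.causalFuture 𝒟.timeOrientation (𝒟.embed '' (Set.range φ)ᶜ)),
          Kerr.radius a (χ p).1 < Kerr.rPlus M a →
          ∀ q ∈ (𝒟.metric.causalFuture 𝒟.timeOrientation (Set.range 𝒟.embed) \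
            𝒟.metric.causalFuture 𝒟.timeOrientation (𝒟.embed '' (Set.range φ)ᶜ)),
            𝒟.toSpacetime.lorentzDist p q ≤ (C : ℝ≥0∞)) ∧
        (∃ rb : ℝ, 0 < rb ∧ ∀ r' : ℝ, 0 < r' → r' ≤ rb → ∃ Λb : ℝ≥0,
          ∀ q ∈ 𝒟.metric.causalFuture 𝒟.timeOrientation (Set.range 𝒟.embed),
          ∀ (p : X) (γ : ℝ → 𝒟.carrier) (dom : Set ℝ),
            𝒟.metric.IsNormalisedNullRayFrom 𝒟.timeOrientation 𝒟.embed 𝒟.normal p γ dom →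
            ¬ BddAbove dom →
            q ∈ 𝒟.metric.chronologicalPast 𝒟.timeOrientation (γ '' (dom ∩ Set.Ici 0)) →
            (γ '' (dom ∩ Set.Ici 0) ∩
                𝒟.metric.causalFuture 𝒟.timeOrientation (𝒟.embed '' (Set.range φ)ᶜ)).Nonempty ∨
              let U : TopologicalSpace.Opens E4 := ⟨Metric.ball (0 : E4) r', Metric.isOpen_ball⟩
              ∃ Φ : U → 𝒟.carrier, 𝒟.toSpacetime.IsLateChart (Minkowski.backgroundOn U) Set.univ (-r') Φ ∧
                (∃ x : U, (x : E4) = 0 ∧ Φ x = q) ∧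
                supCkENorm (U : Set E4) 3 (𝒟.toSpacetime.deviationExtend (Minkowski.backgroundOn U) Φ) ≤
                  (Λb : ℝ≥0∞) ∧
                supCkENorm (U : Set E4) 0 (𝒟.toSpacetime.deviationExtend (Minkowski.backgroundOn U) Φ) ≤
                  1 / 2) := by
  sorry

/-- **STUB O — late charts carry immortal observers (or run to the past)** (def-free form; size M–L; technique:
the tree's deviation calculus `truncDeviationCk`/`supCkENorm` at slab points + Lorentzian causality of the Cauchy
development: `IsCauchyHypersurface` of `ιX`, `exists_isEndlessTimelikeCurve_extends_future`,
`exists_isPastEndless_timelike_shadow`, `IsCauchyHypersurface.isAchronal_holds`, `arcLength_le_lorentzDist`).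
For ANY late chart `Ψ` (any background `(Λ, c, M, a)`, either time orientation, image anywhere) whose near-zone `C²`
deviation tends to `0`, any background point `x₀` at which the stationary Killing vector `Λe₀`
(`e₀ = EuclideanSpace.single 0 1`) is timelike for the background form, and the pushed orbit
`γ s = Ψ(x₀ + sΛe₀)` (an honest curve: `x₀ + sΛe₀` stays in the domain, hypothesis `hdom`; cf. `orbit_mem_domain`):
EITHER `γ` is eventually in `J⁺(ιX)`, `≤`-monotone there, with `d(γ s, γ s') → ∞` (`ℝ≥0`-unbounded `lorentzDist`),
OR `γ` is eventually a PAST-directed timelike curve (`IsFutureTimelikeCurveOn` for the reversed orientation).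
Why true: the orbit has constant rest-frame radius `r(x₀)` and rest-frame time `t(x₀) + s`, so `x₀ + sΛe₀` lies in the
truncated slab `{t = t(x₀)+s, r ≤ r(x₀)}` where `truncDeviationCk … 2 (r x₀) τ → 0` controls `Ψ^*g − g_B` in `C⁰`;
`g_B` is stationary along `Λe₀` (`Kerr.bilin_add_smul_basisVector_zero`), so `g(γ', γ') → g_B(x₀)(Λe₀, Λe₀) < 0`:
`γ` is timelike of speed `≥ κ > 0` for `s ≥ s₁`, of one orientation by continuity; in the future case the endless
extension of `γ|[s₁,∞)` (or of its timelike shadow) meets the Cauchy hypersurface `ιX` exactly once, which places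
`γ` eventually in `J⁺(ιX)`; monotonicity is "timelike segment ⇒ causal relation"; unboundedness is
`arcLength_le_lorentzDist` with `arcLength ≥ κ (s' − s)`. -/
theorem stub_immortalObservers :
    ∀ (X : Type) [TopologicalSpace X] [ChartedSpace E3 X] [IsManifold (𝓡 3) ∞ X] [T2Space X]
      [SecondCountableTopology X] [ConnectedSpace X] (D : InitialDataSet (𝓡 3) X)
      (𝒟 : VacuumCauchyDevelopment D)
      (Λ : lorentzGroup) (c : E4) (M a : ℝ) (τ₀ : ℝ)
      (Ψ : (boostedKerrBackground Λ c M a).domain → 𝒟.carrier),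
      𝒟.toSpacetime.IsLateChart (boostedKerrBackground Λ c M a) Set.univ τ₀ Ψ →
      (∀ R : ℝ, Tendsto (fun τ => 𝒟.toSpacetime.truncDeviationCk
        (boostedKerrBackground Λ c M a) Ψ 2 R τ) atTop (𝓝 0)) →
      ∀ (x₀ : (boostedKerrBackground Λ c M a).domain) (γ : ℝ → 𝒟.carrier)
        (hdom : ∀ s : ℝ, (x₀ : E4) + s • (Λ : E4 ≃L[ℝ] E4) (EuclideanSpace.single (0 : Fin 4) (1 : ℝ)) ∈
          (boostedKerrBackground Λ c M a).domain),
        (∀ s : ℝ, γ s = Ψ ⟨(x₀ : E4) + s • (Λ : E4 ≃L[ℝ] E4) (EuclideanSpace.single (0 : Fin 4) (1 : ℝ)),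
          hdom s⟩) →
        (boostedKerrBackground Λ c M a).bilin x₀.1
            ((Λ : E4 ≃L[ℝ] E4) (EuclideanSpace.single (0 : Fin 4) (1 : ℝ)))
            ((Λ : E4 ≃L[ℝ] E4) (EuclideanSpace.single (0 : Fin 4) (1 : ℝ))) < 0 →
        (∃ s₀ : ℝ, ∀ s : ℝ, s₀ ≤ s →
            γ s ∈ 𝒟.metric.causalFuture 𝒟.timeOrientation (Set.range 𝒟.embed) ∧
            (∀ s' : ℝ, s ≤ s' → γ s' ∈ 𝒟.metric.causalFuture 𝒟.timeOrientation {γ s}) ∧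
            ∀ τ : ℝ≥0, ∃ s' : ℝ, s ≤ s' ∧
              (τ : ℝ≥0∞) < 𝒟.toSpacetime.lorentzDist (γ s) (γ s')) ∨
        ∃ s₀ : ℝ, 𝒟.metric.IsFutureTimelikeCurveOn 𝒟.timeOrientation.reverse γ (Set.Ici s₀) := by
  sorry

/-- **STUB P — phase rigidity of the Weyl scalar** (def-free form; `[Kerr.Facts]` bound inside; size L; technique:
curvature of the Kerr–Schild metric (`ChartWeyl`/`CoordWeyl`, Abdelqader–Lake arXiv:1412.8757 for the closed forms),
`C⁰` control of curvature from the `C²` control `truncDeviationCk … 2` of the metric at slab points, elementary complex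
analysis). If `g` is exactly sub-extremal Kerr `(M, a)`, `|a| < M`, on the open set `E` (via `χ` into the ingoing chart
`Kerr.spacetime M a r₋`: `χ` smooth on `E`, `χ^* g_{M,a} = g` on `E`), then for every late chart `Ψ` from a boosted
EXTREMAL background `(M', a')` with near-zone `C²` deviation `→ 0` there is a background point `x₀` — a rest-frame
polar-axis point at radius `r' ∈ (M', (1+η)M')`, where `∂_{t*}` is timelike (`g'(∂_t,∂_t) = −Δ'/(r'² + a'²) < 0`) — whose
pushed Killing orbit `γ s = Ψ(x₀ + sΛe₀)` is NOT eventually inside `E` at Kerr–Schild radius `≥ r₊(M, a)`: along the orbit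
the type-D invariant `Ψ₂ = −3J/I` of `Ψ^* g` tends to `−M'/(r' − iM')³` (phase within `O(η)` of `−45°`), whereas on exact
Kerr `(M, a)` at `r ≥ r₊ > |a|` one has `Ψ₂ = −M/(r − i a cos θ)³` with phase in `[180° − 3α, 180° + 3α]`,
`α = arctan(|a|/r₊) < 45°`. -/
theorem stub_phaseRigidity :
    ∀ [Kerr.Facts] (𝓢 : Spacetime.{0} 4) (M a : ℝ) (hM : 0 ≤ M), |a| < M →
    ∀ (E : Set 𝓢.carrier) (χ : 𝓢.carrier → (Kerr.spacetime M a (Kerr.rMinus M a) hM).carrier),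
      IsOpen E → ContMDiffOn (𝓡 4) (𝓡 4) ∞ χ E →
      (∀ p ∈ E, pullbackBilin (I := 𝓡 4) (I' := 𝓡 4) χ
        (Kerr.spacetime M a (Kerr.rMinus M a) hM).metric.val p = 𝓢.metric.val p) →
    ∀ (Λ : lorentzGroup) (c : E4) (M' a' : ℝ), Kerr.IsExtremal M' a' →
    ∀ (τ₀ : ℝ) (Ψ : (boostedKerrBackground Λ c M' a').domain → 𝓢.carrier),
      𝓢.IsLateChart (boostedKerrBackground Λ c M' a') Set.univ τ₀ Ψ →
      (∀ R : ℝ, Tendsto (fun τ => 𝓢.truncDeviationCk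
        (boostedKerrBackground Λ c M' a') Ψ 2 R τ) atTop (𝓝 0)) →
      ∃ x₀ : (boostedKerrBackground Λ c M' a').domain,
        (boostedKerrBackground Λ c M' a').bilin x₀.1
            ((Λ : E4 ≃L[ℝ] E4) (EuclideanSpace.single (0 : Fin 4) (1 : ℝ)))
            ((Λ : E4 ≃L[ℝ] E4) (EuclideanSpace.single (0 : Fin 4) (1 : ℝ))) < 0 ∧
        ∀ (γ : ℝ → 𝓢.carrier)
          (hdom : ∀ s : ℝ, (x₀ : E4) + s • (Λ : E4 ≃L[ℝ] E4) (EuclideanSpace.single (0 : Fin 4) (1 : ℝ)) ∈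
            (boostedKerrBackground Λ c M' a').domain),
          (∀ s : ℝ, γ s = Ψ ⟨(x₀ : E4) + s • (Λ : E4 ≃L[ℝ] E4) (EuclideanSpace.single (0 : Fin 4) (1 : ℝ)),
            hdom s⟩) →
          ¬ ∃ s₀ : ℝ, ∀ s : ℝ, s₀ ≤ s →
              γ s ∈ E ∧ Kerr.rPlus M a ≤ Kerr.radius a (χ (γ s)).1 := by
  sorry

/-- **STUB C — the crush** (def-free, curried form; size L; technique: Hawking 1967 / Wald 1984 Thm 9.5.1 in future form
— the FIRST hypothesis, verbatim the Literature named fact `Literature.Geometry.Lorentzian.HawkingCrushBound` at universe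
`0` — applied in the globally hyperbolic region `int D(S″)` whose Cauchy hypersurface is `S″` (`CauchyDevelopmentRestrict`),
finiteness of the Lorentzian diameter of compact sets and non-imprisonment of future-inextendible causal curves in compact
sets (`IsStronglyCausal.exists_forall_notMem_of_isCompact`, `bernalSanchez_isStronglyCausal_of_isGloballyHyperbolic`), and
NULL TERMINALITY — the SECOND hypothesis, the line's conjectural soft lemma (`stub_nullTerminality`), verbatim). If the
swallowed region `J⁺(ιK)` of a MAXIMAL vacuum Cauchy development is CRUSHABLE — covered up to a compact `C` by `I⁺(S″)`,
`S″ = range f` a closed achronal smooth spacelike hypersurface with smooth future unit normal `ν`, `H = div ν ≤ −ε < 0`,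
future-Cauchy for its own future (`J⁺(S″) ⊆ D⁺(S″)`) — then (C1) NO point `m ∈ J⁺(ιK)` is immortal (`sup_q d(m,q) < ∞`):
a future causal curve from `m` stays in `J⁺(ιK)`, spends length `≤ diam_d(C)` in `C` and `≤ 3/ε` after entering
`I⁺(S″)` (reverse triangle inequality from a point of `S″`); (C2) NO future-COMPLETE normalised null ray from the data
hypersurface meets `J⁺(ιK)`: after the meeting parameter it stays in `J⁺(ιK)`, cannot remain in the compact `C`
(non-imprisonment), so enters `I⁺(S″) ⊆ D⁺(S″)` for good, and null terminality bounds its affine domain. -/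
theorem stub_crush :
    (∀ (𝓢 : Spacetime.{0} 4) [𝓢.metric.HasLeviCivita],
      𝓢.metric.IsGloballyHyperbolic 𝓢.timeOrientation →
      𝓢.metric.SatisfiesTimelikeConvergence →
      ∀ (N : Type) [TopologicalSpace N] [ChartedSpace E3 N] [IsManifold (𝓡 3) ∞ N]
        (f : N → 𝓢.carrier)
        (hpb : PseudoRiemannianMetric.contMDiff_pullbackBilin (𝓡 4) 𝓢.carrier (𝓡 3) N ∞)
        (hf : 𝓢.metric.IsSpacelikeImmersion (𝓡 3) f) (ν : NormalField (𝓡 4) f),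
        ContMDiff (𝓡 3) (𝓡 4).tangent ∞
          (fun y ↦ (TotalSpace.mk' E4 (f y) (ν y) : TangentBundle (𝓡 4) 𝓢.carrier)) →
        𝓢.metric.IsFutureUnitNormal (𝓡 3) 𝓢.timeOrientation f ν →
        𝓢.metric.IsCauchyHypersurface 𝓢.timeOrientation (Set.range f) →
        ∀ C : ℝ, 0 < C → (∀ y, 𝓢.metric.meanCurvature f hpb hf ν y ≤ -C) →
        ∀ (y : N) (q : 𝓢.carrier), 𝓢.lorentzDist (f y) q ≤ ENNReal.ofReal (3 / C)) →
    (∀ (Y : Type) [TopologicalSpace Y] [ChartedSpace E3 Y] [IsManifold (𝓡 3) ∞ Y] [T2Space Y]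
      [SecondCountableTopology Y] [ConnectedSpace Y] (DY : InitialDataSet (𝓡 3) Y)
      (𝒟 : VacuumCauchyDevelopment DY), 𝒟.IsMaximal → ∀ [𝒟.metric.HasLeviCivita]
      (N : Type) [TopologicalSpace N] [ChartedSpace E3 N] [IsManifold (𝓡 3) ∞ N] (f : N → 𝒟.carrier)
      (hpb : PseudoRiemannianMetric.contMDiff_pullbackBilin (𝓡 4) 𝒟.carrier (𝓡 3) N ∞)
      (hf : 𝒟.metric.IsSpacelikeImmersion (𝓡 3) f) (ν : NormalField (𝓡 4) f),
      ContMDiff (𝓡 3) (𝓡 4).tangent ∞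
        (fun y ↦ (TotalSpace.mk' E4 (f y) (ν y) : TangentBundle (𝓡 4) 𝒟.carrier)) →
      𝒟.metric.IsFutureUnitNormal (𝓡 3) 𝒟.timeOrientation f ν →
      IsClosed (Set.range f) → 𝒟.metric.IsAchronal 𝒟.timeOrientation (Set.range f) →
      ∀ ε : ℝ, 0 < ε → (∀ y, 𝒟.metric.meanCurvature f hpb hf ν y ≤ -ε) →
      ∀ (γ : ℝ → 𝒟.carrier) (dom : Set ℝ), IsMaximalGeodesicOn 𝒟.metric.leviCivita γ dom →
        (∃ t ∈ dom, 𝒟.metric.IsNull (velocity (𝓡 4) γ t) ∧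
          𝒟.timeOrientation.IsFutureDirected (velocity (𝓡 4) γ t)) →
        (∃ t₀ ∈ dom, ∀ t ∈ dom, t₀ ≤ t →
          γ t ∈ {p : 𝒟.carrier | ∀ (β : ℝ → 𝒟.carrier) (s : Set ℝ), s.OrdConnected → 𝒟.metric.IsFutureCausalCurveOn 𝒟.timeOrientation β s → IsPastEndless β s → ∀ t₀ ∈ s, β t₀ = p → ∃ t ∈ s, t ≤ t₀ ∧ β t ∈ Set.range f}) →
        BddAbove dom) →
    ∀ (X : Type) [TopologicalSpace X] [ChartedSpace E3 X] [IsManifold (𝓡 3) ∞ X] [T2Space X]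
      [SecondCountableTopology X] [ConnectedSpace X] (D : InitialDataSet (𝓡 3) X)
      (𝒟 : VacuumCauchyDevelopment D), 𝒟.IsMaximal → ∀ [𝒟.metric.HasLeviCivita] (K : Set X)
      (N : Type) [TopologicalSpace N] [ChartedSpace E3 N] [IsManifold (𝓡 3) ∞ N]
      (f : N → 𝒟.carrier)
      (hpb : PseudoRiemannianMetric.contMDiff_pullbackBilin (𝓡 4) 𝒟.carrier (𝓡 3) N ∞)
      (hf : 𝒟.metric.IsSpacelikeImmersion (𝓡 3) f) (ν : NormalField (𝓡 4) f) (ε : ℝ),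
      0 < ε →
      ContMDiff (𝓡 3) (𝓡 4).tangent ∞
        (fun y ↦ (TotalSpace.mk' E4 (f y) (ν y) : TangentBundle (𝓡 4) 𝒟.carrier)) →
      𝒟.metric.IsFutureUnitNormal (𝓡 3) 𝒟.timeOrientation f ν →
      (∀ y, 𝒟.metric.meanCurvature f hpb hf ν y ≤ -ε) →
      IsClosed (Set.range f) → 𝒟.metric.IsAchronal 𝒟.timeOrientation (Set.range f) →
      𝒟.metric.causalFuture 𝒟.timeOrientation (Set.range f) ⊆
        {p : 𝒟.carrier | ∀ (β : ℝ → 𝒟.carrier) (s : Set ℝ), s.OrdConnected → 𝒟.metric.IsFutureCausalCurveOn 𝒟.timeOrientation β s → IsPastEndless β s → ∀ t₀ ∈ s, β t₀ = p → ∃ t ∈ s, t ≤ t₀ ∧ β t ∈ Set.range f} →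
      ∀ C : Set 𝒟.carrier, IsCompact C →
      𝒟.metric.causalFuture 𝒟.timeOrientation (𝒟.embed '' K) ⊆
        C ∪ 𝒟.metric.chronologicalFuture 𝒟.timeOrientation (Set.range f) →
      (∀ m ∈ 𝒟.metric.causalFuture 𝒟.timeOrientation (𝒟.embed '' K),
        ¬ ∀ τ : ℝ≥0, ∃ q : 𝒟.carrier, (τ : ℝ≥0∞) < 𝒟.toSpacetime.lorentzDist m q) ∧
      ∀ (p : X) (γ : ℝ → 𝒟.carrier) (dom : Set ℝ),
        𝒟.metric.IsNormalisedNullRayFrom 𝒟.timeOrientation 𝒟.embed 𝒟.normal p γ dom →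
        ¬ BddAbove dom →
        γ '' (dom ∩ Set.Ici 0) ∩ 𝒟.metric.causalFuture 𝒟.timeOrientation (𝒟.embed '' K) = ∅ := by
  sorry

/-- **STUB H — Hawking's crush bound** (REGISTERED so that the composition takes it BY NAME; statement = VERBATIM the
Literature named fact `Literature.Geometry.Lorentzian.HawkingCrushBound` (Wald 1984, Thm. 9.5.1, future form) at universe `0`,
i.e. `HawkingCrushBound₀` unfolded: a KNOWN theorem whose in-tree discharge is the literature-prover debt
`HawkingCrushBound_holds` (XL: maximising geodesics + conjugate points, Wald Thm 9.4.3/9.4.5 + Prop 9.3.4); a stub-worker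
lands it only as `:= Literature.Geometry.Lorentzian.HawkingCrushBound_holds` once that exists). In a globally hyperbolic
spacetime satisfying the timelike convergence condition, a smooth spacelike Cauchy hypersurface with `H = div ν ≤ −C < 0`
bounds every future timelike curve from it by `3/C`. -/
theorem stub_hawkingCrushBound :
    ∀ (𝓢 : Spacetime.{0} 4) [𝓢.metric.HasLeviCivita],
      𝓢.metric.IsGloballyHyperbolic 𝓢.timeOrientation →
      𝓢.metric.SatisfiesTimelikeConvergence →
      ∀ (N : Type) [TopologicalSpace N] [ChartedSpace E3 N] [IsManifold (𝓡 3) ∞ N]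
        (f : N → 𝓢.carrier)
        (hpb : PseudoRiemannianMetric.contMDiff_pullbackBilin (𝓡 4) 𝓢.carrier (𝓡 3) N ∞)
        (hf : 𝓢.metric.IsSpacelikeImmersion (𝓡 3) f) (ν : NormalField (𝓡 4) f),
        ContMDiff (𝓡 3) (𝓡 4).tangent ∞
          (fun y ↦ (TotalSpace.mk' E4 (f y) (ν y) : TangentBundle (𝓡 4) 𝓢.carrier)) →
        𝓢.metric.IsFutureUnitNormal (𝓡 3) 𝓢.timeOrientation f ν →
        𝓢.metric.IsCauchyHypersurface 𝓢.timeOrientation (Set.range f) →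
        ∀ C : ℝ, 0 < C → (∀ y, 𝓢.metric.meanCurvature f hpb hf ν y ≤ -C) →
        ∀ (y : N) (q : 𝓢.carrier), 𝓢.lorentzDist (f y) q ≤ ENNReal.ofReal (3 / C) := by
  sorry

/-- **STUB N — null terminality** (`NullTerminality`, stated in full; the card's riskiest SOFT lemma, size L,
CONJECTURAL: proposed proof via the monotone expansion-weighted photon energy `|θ|·E` along the distance-function
congruence from `S″`, `d ln(|θ|E)/dτ ≥ |θ|/2 + n·∇ln|θ|`, proved on every contracting vacuum Bianchi class-A model;
Hawking–Ellis §5.8 and §8.2; the obstruction is the cut locus of `S″`). CHEAPEST FALSIFIER of the whole line: one MGHD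
with a closed achronal uniformly contracting spacelike `S″` and a future-complete null geodesic eventually inside
`D⁺(S″)` (candidates: polarized Gowdy / Moncrief vacuum spacetimes with a compactly generated Cauchy horizon approached
from the contracting side; Misner/Taub–NUT pass the test: the imprisoned generators are INCOMPLETE). -/
theorem stub_nullTerminality :
    ∀ (Y : Type) [TopologicalSpace Y] [ChartedSpace E3 Y] [IsManifold (𝓡 3) ∞ Y] [T2Space Y]
      [SecondCountableTopology Y] [ConnectedSpace Y] (DY : InitialDataSet (𝓡 3) Y)
      (𝒟 : VacuumCauchyDevelopment DY), 𝒟.IsMaximal → ∀ [𝒟.metric.HasLeviCivita]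
      (N : Type) [TopologicalSpace N] [ChartedSpace E3 N] [IsManifold (𝓡 3) ∞ N] (f : N → 𝒟.carrier)
      (hpb : PseudoRiemannianMetric.contMDiff_pullbackBilin (𝓡 4) 𝒟.carrier (𝓡 3) N ∞)
      (hf : 𝒟.metric.IsSpacelikeImmersion (𝓡 3) f) (ν : NormalField (𝓡 4) f),
      ContMDiff (𝓡 3) (𝓡 4).tangent ∞
        (fun y ↦ (TotalSpace.mk' E4 (f y) (ν y) : TangentBundle (𝓡 4) 𝒟.carrier)) →
      𝒟.metric.IsFutureUnitNormal (𝓡 3) 𝒟.timeOrientation f ν →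
      IsClosed (Set.range f) → 𝒟.metric.IsAchronal 𝒟.timeOrientation (Set.range f) →
      ∀ ε : ℝ, 0 < ε → (∀ y, 𝒟.metric.meanCurvature f hpb hf ν y ≤ -ε) →
      ∀ (γ : ℝ → 𝒟.carrier) (dom : Set ℝ), IsMaximalGeodesicOn 𝒟.metric.leviCivita γ dom →
        (∃ t ∈ dom, 𝒟.metric.IsNull (velocity (𝓡 4) γ t) ∧
          𝒟.timeOrientation.IsFutureDirected (velocity (𝓡 4) γ t)) →
        (∃ t₀ ∈ dom, ∀ t ∈ dom, t₀ ≤ t →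
          γ t ∈ {p : 𝒟.carrier | ∀ (β : ℝ → 𝒟.carrier) (s : Set ℝ), s.OrdConnected → 𝒟.metric.IsFutureCausalCurveOn 𝒟.timeOrientation β s → IsPastEndless β s → ∀ t₀ ∈ s, β t₀ = p → ∃ t ∈ s, t ≤ t₀ ∧ β t ∈ Set.range f}) →
        BddAbove dom := by
  sorry

/-- **STUB R — THE RESIDUE** (def-free form; `[Kerr.Facts]` bound inside; OPEN-PROBLEM level, named by all three
triagers; held by the lead; both conjuncts are VACUOUS under the recommended lockstep repair of K3/K2 — restrict clause
(i) to charts into `J⁺(ιX)` and clauses (i),(ii) to the visible sector). For a Kerr-shielded admissible datum (block =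
VERBATIM the member clause of `ParametricKerrBurial`) and any MGHD: (R2, PAST THIRD LAW) no late chart from a boosted
extremal background with near-zone `C²` deviation `→ 0` has a pushed Killing orbit of a timelike-Killing point that is
eventually PAST-directed timelike; (R1, UNCRUSHABLE SWALLOWED SECTORS ARE TAME) if the swallowed region `J⁺(ι(range φ)ᶜ)`
admits NO crush hypersurface (eternal hidden futures), then still no such orbit is eventually swallowed and the pasts of
complete rays meeting the swallowed region carry uniform Minkowski-ball charts. Not claimed provable as typed (universal
over cores; R2 fails on a core whose reversed development forms an extremal remnant — Kehle–Unger codimension-one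
picture, arXiv:2211.15742 / arXiv:2402.10190); it is the honest price of the LITERAL decl. -/
theorem stub_residue : ∀ [Kerr.Facts],
    ∀ (X : Type) [TopologicalSpace X] [ChartedSpace E3 X] [IsManifold (𝓡 3) ∞ X] [T2Space X]
      [SecondCountableTopology X] [ConnectedSpace X],
    ∀ D ∈ admissibleVacuumData X,
    ∀ (M a r₁ : ℝ) (hM : 0 ≤ M) (T : ℝ → ℝ) (φ : Kerr.slice a r₁ → X)
      (ψ : Kerr.slice a r₁ → Kerr.region a r₁) (ν : NormalField 𝓘(ℝ, E4) ψ),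
      (|a| < M ∧ Kerr.rMinus M a < r₁ ∧ r₁ < Kerr.rPlus M a ∧
        T = (fun r : ℝ => Real.smoothTransition (r / (4 * M) - 1) * (((M) / Real.sqrt ((M) ^ 2 - (a) ^ 2)) * (Kerr.rPlus M a * Real.log (r - Kerr.rPlus M a) - Kerr.rMinus M a * Real.log (r - Kerr.rMinus M a)) - ((M) / Real.sqrt ((M) ^ 2 - (a) ^ 2)) * (Kerr.rPlus M a * Real.log ((4 * M) - Kerr.rPlus M a) - Kerr.rMinus M a * Real.log ((4 * M) - Kerr.rMinus M a)))) ∧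
        IsCompact (Set.range φ)ᶜ ∧ Topology.IsOpenEmbedding φ ∧ ContMDiff 𝓘(ℝ, E3) (𝓡 3) ((⊤ : ℕ∞) : WithTop ℕ∞) φ ∧
        (∀ y : Kerr.slice a r₁, (ψ y : E4) = E4.ofTimeSpace (T (Kerr.radius a (E4.ofTimeSpace 0 (y : E3)))) (y : E3)) ∧
        (Kerr.smoothMetric M a r₁).IsSpacelikeImmersion 𝓘(ℝ, E3) ψ ∧
        (Kerr.smoothMetric M a r₁).IsFutureUnitNormal 𝓘(ℝ, E3) ((Kerr.timeOrientation M a r₁ hM).ofLE le_top) ψ ν ∧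
        (∀ y : Kerr.slice a r₁, pullbackBilin (I := 𝓡 3) (I' := 𝓘(ℝ, E3)) φ D.h.inner y = pullbackBilin (I := 𝓘(ℝ, E4)) (I' := 𝓘(ℝ, E3)) ψ (Kerr.smoothMetric M a r₁).val y) ∧
        (∀ [(Kerr.smoothMetric M a r₁).HasLeviCivita] (y : Kerr.slice a r₁), (pullbackBilin (I := 𝓡 3) (I' := 𝓘(ℝ, E3)) φ D.k y).toLinearMap₁₂ = (Kerr.smoothMetric M a r₁).secondFundamentalForm 𝓘(ℝ, E3) ψ ν y)) →
    ∀ 𝒟 : VacuumCauchyDevelopment D, 𝒟.IsMaximal → ∀ [𝒟.metric.HasLeviCivita],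
      (∀ (Λ : lorentzGroup) (c : E4) (M' a' : ℝ), Kerr.IsExtremal M' a' →
        ∀ (τ₀ : ℝ) (Ψ : (boostedKerrBackground Λ c M' a').domain → 𝒟.carrier),
          𝒟.toSpacetime.IsLateChart (boostedKerrBackground Λ c M' a') Set.univ τ₀ Ψ →
          (∀ R : ℝ, Tendsto (fun τ => 𝒟.toSpacetime.truncDeviationCk
            (boostedKerrBackground Λ c M' a') Ψ 2 R τ) atTop (𝓝 0)) →
          ∀ (x₀ : (boostedKerrBackground Λ c M' a').domain) (γ : ℝ → 𝒟.carrier)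
            (hdom : ∀ s : ℝ, (x₀ : E4) + s • (Λ : E4 ≃L[ℝ] E4) (EuclideanSpace.single (0 : Fin 4) (1 : ℝ)) ∈
              (boostedKerrBackground Λ c M' a').domain),
            (∀ s : ℝ, γ s = Ψ ⟨(x₀ : E4) + s • (Λ : E4 ≃L[ℝ] E4) (EuclideanSpace.single (0 : Fin 4) (1 : ℝ)),
              hdom s⟩) →
            (boostedKerrBackground Λ c M' a').bilin x₀.1
                ((Λ : E4 ≃L[ℝ] E4) (EuclideanSpace.single (0 : Fin 4) (1 : ℝ)))
                ((Λ : E4 ≃L[ℝ] E4) (EuclideanSpace.single (0 : Fin 4) (1 : ℝ))) < 0 →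
            ¬ ∃ s₀ : ℝ, 𝒟.metric.IsFutureTimelikeCurveOn 𝒟.timeOrientation.reverse γ (Set.Ici s₀)) ∧
      ((¬ ∃ (N : Type) (_ : TopologicalSpace N) (_ : ChartedSpace E3 N) (_ : IsManifold (𝓡 3) ∞ N)
          (f : N → 𝒟.carrier)
          (hpb : PseudoRiemannianMetric.contMDiff_pullbackBilin (𝓡 4) 𝒟.carrier (𝓡 3) N ∞)
          (hf : 𝒟.metric.IsSpacelikeImmersion (𝓡 3) f) (ν : NormalField (𝓡 4) f) (ε : ℝ),
          0 < ε ∧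
          ContMDiff (𝓡 3) (𝓡 4).tangent ∞
            (fun y ↦ (TotalSpace.mk' E4 (f y) (ν y) : TangentBundle (𝓡 4) 𝒟.carrier)) ∧
          𝒟.metric.IsFutureUnitNormal (𝓡 3) 𝒟.timeOrientation f ν ∧
          (∀ y, 𝒟.metric.meanCurvature f hpb hf ν y ≤ -ε) ∧
          IsClosed (Set.range f) ∧ 𝒟.metric.IsAchronal 𝒟.timeOrientation (Set.range f) ∧
          𝒟.metric.causalFuture 𝒟.timeOrientation (Set.range f) ⊆
            {p : 𝒟.carrier | ∀ (β : ℝ → 𝒟.carrier) (s : Set ℝ), s.OrdConnected → 𝒟.metric.IsFutureCausalCurveOn 𝒟.timeOrientation β s → IsPastEndless β s → ∀ t₀ ∈ s, β t₀ = p → ∃ t ∈ s, t ≤ t₀ ∧ β t ∈ Set.range f} ∧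
          ∃ C : Set 𝒟.carrier, IsCompact C ∧
            𝒟.metric.causalFuture 𝒟.timeOrientation (𝒟.embed '' (Set.range φ)ᶜ) ⊆
              C ∪ 𝒟.metric.chronologicalFuture 𝒟.timeOrientation (Set.range f)) →
        (∀ (Λ : lorentzGroup) (c : E4) (M' a' : ℝ), Kerr.IsExtremal M' a' →
          ∀ (τ₀ : ℝ) (Ψ : (boostedKerrBackground Λ c M' a').domain → 𝒟.carrier),
            𝒟.toSpacetime.IsLateChart (boostedKerrBackground Λ c M' a') Set.univ τ₀ Ψ →
            (∀ R : ℝ, Tendsto (fun τ => 𝒟.toSpacetime.truncDeviationCk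
              (boostedKerrBackground Λ c M' a') Ψ 2 R τ) atTop (𝓝 0)) →
            ∀ (x₀ : (boostedKerrBackground Λ c M' a').domain) (γ : ℝ → 𝒟.carrier)
              (hdom : ∀ s : ℝ, (x₀ : E4) + s • (Λ : E4 ≃L[ℝ] E4) (EuclideanSpace.single (0 : Fin 4) (1 : ℝ)) ∈
                (boostedKerrBackground Λ c M' a').domain),
              (∀ s : ℝ, γ s = Ψ ⟨(x₀ : E4) + s • (Λ : E4 ≃L[ℝ] E4) (EuclideanSpace.single (0 : Fin 4) (1 : ℝ)),
                hdom s⟩) →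
              (boostedKerrBackground Λ c M' a').bilin x₀.1
                  ((Λ : E4 ≃L[ℝ] E4) (EuclideanSpace.single (0 : Fin 4) (1 : ℝ)))
                  ((Λ : E4 ≃L[ℝ] E4) (EuclideanSpace.single (0 : Fin 4) (1 : ℝ))) < 0 →
              ¬ ∃ s₀ : ℝ, ∀ s : ℝ, s₀ ≤ s →
                  γ s ∈ 𝒟.metric.causalFuture 𝒟.timeOrientation (𝒟.embed '' (Set.range φ)ᶜ)) ∧
        (∃ rb : ℝ, 0 < rb ∧ ∀ r' : ℝ, 0 < r' → r' ≤ rb → ∃ Λ' : ℝ≥0,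
          ∀ q ∈ 𝒟.metric.causalFuture 𝒟.timeOrientation (Set.range 𝒟.embed),
          ∀ (p : X) (γ : ℝ → 𝒟.carrier) (dom : Set ℝ),
            𝒟.metric.IsNormalisedNullRayFrom 𝒟.timeOrientation 𝒟.embed 𝒟.normal p γ dom → ¬ BddAbove dom →
            q ∈ 𝒟.metric.chronologicalPast 𝒟.timeOrientation (γ '' (dom ∩ Set.Ici 0)) →
            (γ '' (dom ∩ Set.Ici 0) ∩
                𝒟.metric.causalFuture 𝒟.timeOrientation (𝒟.embed '' (Set.range φ)ᶜ)).Nonempty →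
            let U : TopologicalSpace.Opens E4 := ⟨Metric.ball (0 : E4) r', Metric.isOpen_ball⟩
            ∃ Φ : U → 𝒟.carrier, 𝒟.toSpacetime.IsLateChart (Minkowski.backgroundOn U) Set.univ (-r') Φ ∧
              (∃ x : U, (x : E4) = 0 ∧ Φ x = q) ∧
              supCkENorm (U : Set E4) 3 (𝒟.toSpacetime.deviationExtend (Minkowski.backgroundOn U) Φ) ≤
                (Λ' : ℝ≥0∞) ∧
              supCkENorm (U : Set E4) 0 (𝒟.toSpacetime.deviationExtend (Minkowski.backgroundOn U) Φ) ≤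
                1 / 2)) := by
  sorry

/-! ## Folded forms of the stubs (bridges over the canonical objects; definitional)

The planner's statements over `IsKerrShieldedWith`, `swallowed`, `exactPart`, `IsExactKerrOn`, `BallChart`, `orbitPt`,
`IsPastGoingOrbit`, `IsImmortal`, `IsCrushable`, `NullTerminality`, `NoOrbitSwallowed`, `SwallowedRaysTame`, recovered from
the def-free registered stubs: every canonical object is by definition the inlined text, and the pushed orbit `orbitPt` is
fed to the stubs as the curve `γ` with `orbit_mem_domain` and `rfl`. -/

/-- Folded form of `stub_exactKerrBookkeeping` (planner's statement B, verbatim). -/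
theorem exactKerrBookkeeping_folded : SubdataDevelopmentsEmbed →
    ∀ (X : Type) [TopologicalSpace X] [ChartedSpace E3 X] [IsManifold (𝓡 3) ∞ X] [T2Space X]
      [SecondCountableTopology X] [ConnectedSpace X],
    ∀ D ∈ admissibleVacuumData X,
    ∀ (M a r₁ : ℝ) (hM : 0 ≤ M) (T : ℝ → ℝ) (φ : Kerr.slice a r₁ → X)
      (ψ : Kerr.slice a r₁ → Kerr.region a r₁) (ν : NormalField 𝓘(ℝ, E4) ψ),
      IsKerrShieldedWith D M a r₁ hM T φ ψ ν →
    ∀ 𝒟 : VacuumCauchyDevelopment D, 𝒟.IsMaximal → ∀ [𝒟.metric.HasLeviCivita],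
      ∃ (E' : Set 𝒟.carrier) (χ : 𝒟.carrier → (Kerr.spacetime M a (Kerr.rMinus M a) hM).carrier),
        exactPart 𝒟 (Set.range φ)ᶜ ⊆ E' ∧
        IsExactKerrOn 𝒟.toSpacetime E' M a (Kerr.rMinus M a) hM χ ∧
        (∀ m ∈ swallowed 𝒟 (Set.range φ)ᶜ,
          𝒟.metric.causalFuture 𝒟.timeOrientation {m} ⊆ swallowed 𝒟 (Set.range φ)ᶜ) ∧
        (∃ C : ℝ≥0, ∀ p ∈ exactPart 𝒟 (Set.range φ)ᶜ,
          Kerr.radius a (χ p).1 < Kerr.rPlus M a →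
          ∀ q ∈ exactPart 𝒟 (Set.range φ)ᶜ, 𝒟.toSpacetime.lorentzDist p q ≤ (C : ℝ≥0∞)) ∧
        (∃ rb : ℝ, 0 < rb ∧ ∀ r' : ℝ, 0 < r' → r' ≤ rb → ∃ Λb : ℝ≥0,
          ∀ q ∈ 𝒟.metric.causalFuture 𝒟.timeOrientation (Set.range 𝒟.embed),
          ∀ (p : X) (γ : ℝ → 𝒟.carrier) (dom : Set ℝ),
            𝒟.metric.IsNormalisedNullRayFrom 𝒟.timeOrientation 𝒟.embed 𝒟.normal p γ dom →
            ¬ BddAbove dom →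
            q ∈ 𝒟.metric.chronologicalPast 𝒟.timeOrientation (γ '' (dom ∩ Set.Ici 0)) →
            (γ '' (dom ∩ Set.Ici 0) ∩ swallowed 𝒟 (Set.range φ)ᶜ).Nonempty ∨
              BallChart 𝒟.toSpacetime q r' Λb) :=
  fun hE X _ _ _ _ _ _ D hD M a r₁ hM T φ ψ ν hsh 𝒟 hmax _ =>
    stub_exactKerrBookkeeping hE X D hD M a r₁ hM T φ ψ ν hsh 𝒟 hmax

/-- Folded form of `stub_immortalObservers` (planner's statement O, verbatim; `γ := orbitPt`). -/
theorem immortalObservers_folded :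
    ∀ (X : Type) [TopologicalSpace X] [ChartedSpace E3 X] [IsManifold (𝓡 3) ∞ X] [T2Space X]
      [SecondCountableTopology X] [ConnectedSpace X] (D : InitialDataSet (𝓡 3) X)
      (𝒟 : VacuumCauchyDevelopment D)
      (Λ : lorentzGroup) (c : E4) (M a : ℝ) (τ₀ : ℝ)
      (Ψ : (boostedKerrBackground Λ c M a).domain → 𝒟.carrier),
      𝒟.toSpacetime.IsLateChart (boostedKerrBackground Λ c M a) Set.univ τ₀ Ψ →
      (∀ R : ℝ, Tendsto (fun τ => 𝒟.toSpacetime.truncDeviationCk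
        (boostedKerrBackground Λ c M a) Ψ 2 R τ) atTop (𝓝 0)) →
      ∀ x₀ : (boostedKerrBackground Λ c M a).domain,
        (boostedKerrBackground Λ c M a).bilin x₀.1 (killingDir Λ) (killingDir Λ) < 0 →
        (∃ s₀ : ℝ, ∀ s : ℝ, s₀ ≤ s →
            orbitPt Λ c M a 𝒟.toSpacetime Ψ x₀ s ∈
              𝒟.metric.causalFuture 𝒟.timeOrientation (Set.range 𝒟.embed) ∧
            (∀ s' : ℝ, s ≤ s' → orbitPt Λ c M a 𝒟.toSpacetime Ψ x₀ s' ∈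
              𝒟.metric.causalFuture 𝒟.timeOrientation {orbitPt Λ c M a 𝒟.toSpacetime Ψ x₀ s}) ∧
            ∀ τ : ℝ≥0, ∃ s' : ℝ, s ≤ s' ∧
              (τ : ℝ≥0∞) < 𝒟.toSpacetime.lorentzDist (orbitPt Λ c M a 𝒟.toSpacetime Ψ x₀ s)
                (orbitPt Λ c M a 𝒟.toSpacetime Ψ x₀ s')) ∨
        IsPastGoingOrbit Λ c M a 𝒟.toSpacetime Ψ x₀ :=
  fun X _ _ _ _ _ _ D 𝒟 Λ c M a τ₀ Ψ hΨ hdev x₀ hx₀ =>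
    stub_immortalObservers X D 𝒟 Λ c M a τ₀ Ψ hΨ hdev x₀ (orbitPt Λ c M a 𝒟.toSpacetime Ψ x₀)
      (orbit_mem_domain Λ c M a x₀) (fun _ => rfl) hx₀

/-- Folded form of `stub_phaseRigidity` (planner's statement P, verbatim; `γ := orbitPt`). -/
theorem phaseRigidity_folded :
    ∀ (𝓢 : Spacetime.{0} 4) (M a : ℝ) (hM : 0 ≤ M), |a| < M →
    ∀ (E : Set 𝓢.carrier) (χ : 𝓢.carrier → (Kerr.spacetime M a (Kerr.rMinus M a) hM).carrier),
      IsExactKerrOn 𝓢 E M a (Kerr.rMinus M a) hM χ →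
    ∀ (Λ : lorentzGroup) (c : E4) (M' a' : ℝ), Kerr.IsExtremal M' a' →
    ∀ (τ₀ : ℝ) (Ψ : (boostedKerrBackground Λ c M' a').domain → 𝓢.carrier),
      𝓢.IsLateChart (boostedKerrBackground Λ c M' a') Set.univ τ₀ Ψ →
      (∀ R : ℝ, Tendsto (fun τ => 𝓢.truncDeviationCk
        (boostedKerrBackground Λ c M' a') Ψ 2 R τ) atTop (𝓝 0)) →
      ∃ x₀ : (boostedKerrBackground Λ c M' a').domain,
        (boostedKerrBackground Λ c M' a').bilin x₀.1 (killingDir Λ) (killingDir Λ) < 0 ∧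
        ¬ ∃ s₀ : ℝ, ∀ s : ℝ, s₀ ≤ s →
            orbitPt Λ c M' a' 𝓢 Ψ x₀ s ∈ E ∧
              Kerr.rPlus M a ≤ Kerr.radius a (χ (orbitPt Λ c M' a' 𝓢 Ψ x₀ s)).1 := by
  intro 𝓢 M a hM ha E χ hex Λ c M' a' hext τ₀ Ψ hΨ hdev
  obtain ⟨x₀, hx₀, h⟩ :=
    stub_phaseRigidity 𝓢 M a hM ha E χ hex.1 hex.2.1 hex.2.2 Λ c M' a' hext τ₀ Ψ hΨ hdev
  exact ⟨x₀, hx₀, h _ (orbit_mem_domain Λ c M' a' x₀) (fun _ => rfl)⟩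

/-- Folded form of `stub_crush` (planner's statement C over `IsCrushable`/`IsImmortal`/`swallowed`, with the named fact
`HawkingCrushBound` and the soft lemma `NullTerminality` BY NAME). -/
theorem crush_folded : HawkingCrushBound₀ → NullTerminality →
    ∀ (X : Type) [TopologicalSpace X] [ChartedSpace E3 X] [IsManifold (𝓡 3) ∞ X] [T2Space X]
      [SecondCountableTopology X] [ConnectedSpace X] (D : InitialDataSet (𝓡 3) X)
      (𝒟 : VacuumCauchyDevelopment D), 𝒟.IsMaximal → ∀ [𝒟.metric.HasLeviCivita] (K : Set X),
      IsCrushable 𝒟 K →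
      (∀ m ∈ swallowed 𝒟 K, ¬ IsImmortal 𝒟.toSpacetime m) ∧
      ∀ (p : X) (γ : ℝ → 𝒟.carrier) (dom : Set ℝ),
        𝒟.metric.IsNormalisedNullRayFrom 𝒟.timeOrientation 𝒟.embed 𝒟.normal p γ dom →
        ¬ BddAbove dom → γ '' (dom ∩ Set.Ici 0) ∩ swallowed 𝒟 K = ∅ := by
  intro hH hN X _ _ _ _ _ _ D 𝒟 hmax _ K hcr
  obtain ⟨N, _, _, _, f, hpb, hf, ν, ε, hε, hν, hun, hH', hcl, hach, hDp, C, hC, hcov⟩ := hcr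
  exact stub_crush hH hN X D 𝒟 hmax K N f hpb hf ν ε hε hν hun hH' hcl hach hDp C hC hcov

/-- Folded form of `stub_residue` (planner's statement R over `IsKerrShieldedWith`, `IsPastGoingOrbit`, `IsCrushable`,
`NoOrbitSwallowed`, `SwallowedRaysTame`; `γ := orbitPt`). -/
theorem residue_folded :
    ∀ (X : Type) [TopologicalSpace X] [ChartedSpace E3 X] [IsManifold (𝓡 3) ∞ X] [T2Space X]
      [SecondCountableTopology X] [ConnectedSpace X],
    ∀ D ∈ admissibleVacuumData X,
    ∀ (M a r₁ : ℝ) (hM : 0 ≤ M) (T : ℝ → ℝ) (φ : Kerr.slice a r₁ → X)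
      (ψ : Kerr.slice a r₁ → Kerr.region a r₁) (ν : NormalField 𝓘(ℝ, E4) ψ),
      IsKerrShieldedWith D M a r₁ hM T φ ψ ν →
    ∀ 𝒟 : VacuumCauchyDevelopment D, 𝒟.IsMaximal → ∀ [𝒟.metric.HasLeviCivita],
      (∀ (Λ : lorentzGroup) (c : E4) (M' a' : ℝ), Kerr.IsExtremal M' a' →
        ∀ (τ₀ : ℝ) (Ψ : (boostedKerrBackground Λ c M' a').domain → 𝒟.carrier),
          𝒟.toSpacetime.IsLateChart (boostedKerrBackground Λ c M' a') Set.univ τ₀ Ψ →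
          (∀ R : ℝ, Tendsto (fun τ => 𝒟.toSpacetime.truncDeviationCk
            (boostedKerrBackground Λ c M' a') Ψ 2 R τ) atTop (𝓝 0)) →
          ∀ x₀ : (boostedKerrBackground Λ c M' a').domain,
            (boostedKerrBackground Λ c M' a').bilin x₀.1 (killingDir Λ) (killingDir Λ) < 0 →
            ¬ IsPastGoingOrbit Λ c M' a' 𝒟.toSpacetime Ψ x₀) ∧
      (¬ IsCrushable 𝒟 (Set.range φ)ᶜ →
        NoOrbitSwallowed 𝒟 (Set.range φ)ᶜ ∧ SwallowedRaysTame 𝒟 (Set.range φ)ᶜ) := by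
  intro X _ _ _ _ _ _ D hD M a r₁ hM T φ ψ ν hsh 𝒟 hmax _
  obtain ⟨h2, h1⟩ := stub_residue X D hD M a r₁ hM T φ ψ ν hsh 𝒟 hmax
  refine ⟨fun Λ c M' a' hext τ₀ Ψ hΨ hdev x₀ hx₀ =>
    h2 Λ c M' a' hext τ₀ Ψ hΨ hdev x₀ _ (orbit_mem_domain Λ c M' a' x₀) (fun _ => rfl) hx₀, fun hncr => ?_⟩
  obtain ⟨hA, hB⟩ := h1 hncr
  exact ⟨fun Λ c M' a' hext τ₀ Ψ hΨ hdev x₀ hx₀ =>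
    hA Λ c M' a' hext τ₀ Ψ hΨ hdev x₀ _ (orbit_mem_domain Λ c M' a' x₀) (fun _ => rfl) hx₀, hB⟩

/-! ## The composition: the stubs give the crux BY NAME -/

/-- **`TameCensorship` from the line `crush-the-swallowed-interior`** (kernel-checked; no `sorry` of its own;
axioms `propext`/`Classical.choice`/`Quot.sound` + `sorryAx` through the six stubs only; the stubs enter through their `*_folded` forms). Hypotheses = the four
items of route SwallowTheDatum BY NAME: `ParametricKerrBurial` (stmt-10052), `KerrShieldedSettles` (10054),
`SubdataDevelopmentsEmbed` (10053), `MGHDExists` (9937). Proof: unfold curve-genericity; through the given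
admissible datum take the burial family `F`; for `c ≠ 0`, `F c` is Kerr-shielded, so `∃`-MGHD is `MGHDExists`,
complete `𝓘⁺` is `KerrShieldedSettles`; fix an MGHD `𝒟`, get the exact part `E ⊆ E'`, `χ`, future-closedness,
the hole diameter `C` and the ray alternative from STUB B, and the tameness of the swallowed sector
(`NoOrbitSwallowed ∧ SwallowedRaysTame`) either from STUB C + STUB N (crushable case: no immortal point, no
swallowed complete ray — an orbit eventually swallowed would be an immortal swallowed point by STUB O) or from
STUB R (uncrushable case). Clause (i): STUB P gives a test point `x₀`; by STUB O its orbit is future-going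
(else STUB R, R2): eventually in `J⁺(ιX)`, never swallowed, hence in `E`; an orbit point with `r(χ ·) < r₊`
would have `d ≤ C` to all later orbit points, contradicting unboundedness — so the orbit is eventually in `E'`
at `r ≥ r₊`, contradicting STUB P. Clause (ii): at scale `min r_b r_b'` with bound `max Λ_b Λ'`, every point of
`outer` gets its ball chart from STUB B's alternative or from `SwallowedRaysTame`. -/
theorem TameCensorship_of (hB : ParametricKerrBurial) (hS : KerrShieldedSettles)
    (hE : SubdataDevelopmentsEmbed) (hM : MGHDExists) : TameCensorship := by
  intro X _ _ _ _ _ _ d hd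
  obtain ⟨F, hF, h0, hinj, hadm, hshield⟩ := hB X d hd.1
  refine ⟨F, hF, h0, hinj, hadm, fun c hc hmem => hmem.2 ?_⟩
  obtain ⟨M, a, r₁, hM0, T, φ, ψ, ν, hsh⟩ := hshield c hc
  have hsh' : IsKerrShieldedWith (F c) M a r₁ hM0 T φ ψ ν := hsh
  refine ⟨hM X (F c) (hadm c), fun 𝒟 hmax => ?_⟩
  haveI hLC : 𝒟.metric.HasLeviCivita := 𝒟.metric.hasLeviCivita
  have hsettle := hS X (F c) (hadm c) ⟨M, a, r₁, hM0, T, φ, ψ, ν, hsh⟩ 𝒟 hmax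
  obtain ⟨E', χ, hEE', hexact, hclosed, ⟨C, hdiam⟩, rb, hrb, hgeom⟩ :=
    exactKerrBookkeeping_folded hE X (F c) (hadm c) M a r₁ hM0 T φ ψ ν hsh' 𝒟 hmax
  have hres := residue_folded X (F c) (hadm c) M a r₁ hM0 T φ ψ ν hsh' 𝒟 hmax
  -- tameness of the swallowed sector: from the crush (crushable) or from the residue (uncrushable)
  have hR1 : NoOrbitSwallowed 𝒟 (Set.range φ)ᶜ ∧ SwallowedRaysTame 𝒟 (Set.range φ)ᶜ := by
    by_cases hcr : IsCrushable 𝒟 (Set.range φ)ᶜ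
    · obtain ⟨hterm, hnull⟩ := crush_folded stub_hawkingCrushBound stub_nullTerminality X (F c) 𝒟 hmax (Set.range φ)ᶜ hcr
      refine ⟨?_, ⟨1, one_pos, fun r' _ _ => ⟨0, ?_⟩⟩⟩
      · intro Λ cc M' a' hext τ₀ Ψ hΨ hdev x₀ hx₀ hsw
        obtain ⟨s₁, hs₁⟩ := hsw
        rcases immortalObservers_folded X (F c) 𝒟 Λ cc M' a' τ₀ Ψ hΨ hdev x₀ hx₀ with ⟨s₀, hfut⟩ | hpast
        · obtain ⟨-, -, hunb⟩ := hfut (max s₀ s₁) (le_max_left _ _)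
          refine hterm _ (hs₁ (max s₀ s₁) (le_max_right _ _)) fun τ => ?_
          obtain ⟨s', -, hs'⟩ := hunb τ
          exact ⟨_, hs'⟩
        · exact hres.1 Λ cc M' a' hext τ₀ Ψ hΨ hdev x₀ hx₀ hpast
      · intro q _ p γ dom hray hdom _ hne
        rw [hnull p γ dom hray hdom] at hne
        exact absurd hne Set.not_nonempty_empty
    · exact hres.2 hcr
  refine ⟨hsettle.1, ?_, ?_⟩
  · -- (i) no extremal late chart
    rintro Λ cc M' a' hext ⟨τ₀, Ψ, hΨ, hdev⟩
    obtain ⟨x₀, hx₀, hrig⟩ :=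
      phaseRigidity_folded 𝒟.toSpacetime M a hM0 hsh'.1 E' χ hexact Λ cc M' a' hext τ₀ Ψ hΨ hdev
    rcases immortalObservers_folded X (F c) 𝒟 Λ cc M' a' τ₀ Ψ hΨ hdev x₀ hx₀ with ⟨s₀, hfut⟩ | hpast
    · refine hrig ⟨s₀, fun s hs => ?_⟩
      have hR1a := hR1.1 Λ cc M' a' hext τ₀ Ψ hΨ hdev x₀ hx₀
      have hinE : ∀ s : ℝ, s₀ ≤ s →
          orbitPt Λ cc M' a' 𝒟.toSpacetime Ψ x₀ s ∈ exactPart 𝒟 (Set.range φ)ᶜ :=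
        fun s hs => ⟨(hfut s hs).1,
          fun hin => hR1a ⟨s, fun s' hs' => hclosed _ hin ((hfut s hs).2.1 s' hs')⟩⟩
      refine ⟨hEE' (hinE s hs), ?_⟩
      by_contra hlt
      obtain ⟨s', hs', hlt'⟩ := (hfut s hs).2.2 C
      exact absurd (lt_of_lt_of_le hlt'
        (hdiam _ (hinE s hs) (not_le.1 hlt) _ (hinE s' (hs.trans hs')))) (lt_irrefl _)
    · exact hres.1 Λ cc M' a' hext τ₀ Ψ hΨ hdev x₀ hx₀ hpast
  · -- (ii) tame outer geometry
    intro _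
    obtain ⟨rb', hrb', hgeom'⟩ := hR1.2
    obtain ⟨Λb, hΛb⟩ := hgeom (min rb rb') (lt_min hrb hrb') (min_le_left _ _)
    obtain ⟨Λ', hΛ'⟩ := hgeom' (min rb rb') (lt_min hrb hrb') (min_le_right _ _)
    refine ⟨min rb rb', lt_min hrb hrb', max Λb Λ', fun q hq => ?_⟩
    obtain ⟨hqJ, p, γ, dom, hray, hdom, hqI⟩ := hq
    rcases hΛb q hqJ p γ dom hray hdom hqI with hne | hchart
    · exact BallChart.mono (le_max_right _ _) (hΛ' q hqJ p γ dom hray hdom hqI hne)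
    · exact BallChart.mono (le_max_left _ _) hchart

end Summit.FinalStateConjecture.FinalStateConjecture.Cruxes.TameCensorship.CrushTheSwallowedInterior

end
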